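import Mathlib.Algebra.Algebra.Subalgebra.Centralizer
import Mathlib.RingTheory.Flat.Basic
import Mathlib.LinearAlgebra.FreeModule.Basic
import Mathlib.LinearAlgebra.Basis.Prod
import Mathlib.Data.Sum.Order
import Literature.Algebra.Lie.EnvelopingAdInvariant
import HarnessLib

/-!
# The enveloping algebra of a product of Lie algebras and its centre

Let `L = L₁ × L₂` be a product of Lie algebras over a commutative ring `R`, presented through two
Lie algebra maps `f₁ : L₁ → L`, `f₂ : L₂ → L` with commuting images (`⁅f₁ x, f₂ y⁆ = 0`) which
together give a linear isomorphism `L₁ × L₂ ≅ L`. Then (Bourbaki, LIE I §2.2 Prop. 2 and §2.7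
Cor. 5; Dixmier, *Enveloping Algebras*, 2.2.9–2.2.10):

* `prodMap f₁ f₂ hf : U(L₁) ⊗ U(L₂) →ₐ U(L)`, `a ⊗ b ↦ U(f₁)(a) · U(f₂)(b)`, is an algebra
  homomorphism (`envMap f = U(f)`, `commute_envMap`);
* **it is bijective** (`prodMap_bijective`): in a product Poincaré–Birkhoff–Witt basis
  (`Literature.Algebra.Lie.PBW.pbwBasis`) with the letters of `L₁` placed before those of `L₂`, it sends
  the tensor PBW basis to the PBW basis (`prodMap_tmul_ordMonomial`);
* **the centre of `U(L)` is the image of `Z(U(L₁)) ⊗ Z(U(L₂))`** over a field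
  (`exists_center_tmul_eq`: the centre of a tensor product of algebras is the tensor product of the
  centres, Mathlib's `Subalgebra.centralizer_coe_range_includeLeft_eq_center_tensorProduct`), hence
  `center_le_adjoin`: **`Z(U(L))` is contained in the subalgebra generated by `U(f₁)(Z(U(L₁)))` and
  `U(f₂)(Z(U(L₂)))`** — indeed every central element is a finite sum `∑ U(f₁)(aᵢ) U(f₂)(cᵢ)` with
  `aᵢ, cᵢ` central; conversely `envMap_center_le_center`.

The statements `prodMap_bijective`, `center_le_adjoin`, `center_eq_adjoin` are basis-free (bases and
well-orderings of their index types are chosen inside the proofs). This is the algebraic input for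
"the centre of `U(𝔤𝔩_n(K_∞))` is generated by the centres of the factors `U(𝔤𝔩_n(K_w))`"
(Clozel 1990, §3.3), used by Harish-Chandra's finiteness theorem for `GL_n` over a number field.
The two-block case inside `U(∏_τ 𝔤𝔩_{k+l}(ℂ))` is the tree's `HarishChandraLeviBlocks`, whose
method is followed here. Everything is proved; the definitions are `envMap`, `prodMap`, `combine`, `prodBasis`.

## References

* J. Dixmier, *Enveloping Algebras*, North-Holland Math. Library 14 (1977), 2.1.1, 2.2.9–2.2.10, 4.2
  [Dixmier1977].
* N. Bourbaki, *Lie Groups and Lie Algebras*, Ch. I §2.2 Prop. 2, §2.7 Cor. 5.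
* J. E. Humphreys, *Introduction to Lie Algebras and Representation Theory* (1972), §17.3
  [Humphreys1972].
-/

noncomputable section

-- Mathlib idiom (Mathlib/Algebra/Lie/OfAssociative.lean): the commutator bracket on associative rings
attribute [local instance 100] LieRing.ofAssociativeRing

open scoped TensorProduct
open UniversalEnvelopingAlgebra Literature.Algebra.Lie.PBW

namespace Literature.Algebra.Lie.UEnvProduct

/-! ### The algebra maps `U(f)` and the map from the tensor product -/

section Maps

variable {R : Type*} [CommRing R] {L₁ L₂ L : Type*} [LieRing L₁] [LieAlgebra R L₁]
  [LieRing L₂] [LieAlgebra R L₂] [LieRing L] [LieAlgebra R L]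

/-- The algebra map `U(f) : U(L₁) → U(L)` induced by a Lie algebra map `f : L₁ → L` (functoriality of
the enveloping algebra). Dixmier, 2.1.1. [folklore] -/
def envMap (f : L₁ →ₗ⁅R⁆ L) : UniversalEnvelopingAlgebra R L₁ →ₐ[R] UniversalEnvelopingAlgebra R L :=
  UniversalEnvelopingAlgebra.lift R ((ι R).comp f)

/-- `U(f)` on generators: `U(f)(ι x) = ι (f x)`. [folklore] -/
@[simp]
theorem envMap_ι (f : L₁ →ₗ⁅R⁆ L) (x : L₁) : envMap f (ι R x) = ι R (f x) :=
  lift_ι_apply R _ x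

/-- **Commuting images give commuting subalgebras**: if `⁅f₁ x, f₂ y⁆ = 0` for all `x, y` then
`U(f₁)(a)` and `U(f₂)(b)` commute (`U` is generated by `ι`). [folklore] -/
theorem commute_envMap {f₁ : L₁ →ₗ⁅R⁆ L} {f₂ : L₂ →ₗ⁅R⁆ L} (hf : ∀ x y, ⁅f₁ x, f₂ y⁆ = 0)
    (a : UniversalEnvelopingAlgebra R L₁) (b : UniversalEnvelopingAlgebra R L₂) :
    Commute (envMap f₁ a) (envMap f₂ b) := by
  induction a using Literature.Algebra.Lie.UEnv.induction_on with
  | algebraMap r =>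
    rw [AlgHom.commutes]
    exact Algebra.commute_algebraMap_left r _
  | ι_mem X =>
    rw [envMap_ι]
    induction b using Literature.Algebra.Lie.UEnv.induction_on with
    | algebraMap r =>
      rw [AlgHom.commutes]
      exact Algebra.commute_algebraMap_right r _
    | ι_mem Y =>
      rw [envMap_ι, Commute, SemiconjBy, ← sub_eq_zero, ← LieRing.of_associative_ring_bracket,
        ← LieHom.map_lie, hf, map_zero]
    | mul a b ha hb => rw [map_mul]; exact ha.mul_right hb
    | add a b ha hb => rw [map_add]; exact ha.add_right hb
  | mul a b ha hb => rw [map_mul]; exact ha.mul_left hb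
  | add a b ha hb => rw [map_add]; exact ha.add_left hb

/-- **The product map** `U(L₁) ⊗ U(L₂) → U(L)`, `a ⊗ b ↦ U(f₁)(a) · U(f₂)(b)`, for Lie algebra maps
with commuting images. Bourbaki, LIE I §2.2 Prop. 2. [cite: Dixmier1977, 2.2.10] -/
def prodMap (f₁ : L₁ →ₗ⁅R⁆ L) (f₂ : L₂ →ₗ⁅R⁆ L) (hf : ∀ x y, ⁅f₁ x, f₂ y⁆ = 0) :
    UniversalEnvelopingAlgebra R L₁ ⊗[R] UniversalEnvelopingAlgebra R L₂ →ₐ[R] UniversalEnvelopingAlgebra R L :=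
  Algebra.TensorProduct.lift (envMap f₁) (envMap f₂) (commute_envMap hf)

/-- `prodMap` on pure tensors. [folklore] -/
@[simp]
theorem prodMap_tmul {f₁ : L₁ →ₗ⁅R⁆ L} {f₂ : L₂ →ₗ⁅R⁆ L} (hf : ∀ x y, ⁅f₁ x, f₂ y⁆ = 0)
    (a : UniversalEnvelopingAlgebra R L₁) (b : UniversalEnvelopingAlgebra R L₂) :
    prodMap f₁ f₂ hf (a ⊗ₜ b) = envMap f₁ a * envMap f₂ b :=
  Algebra.TensorProduct.lift_tmul _ _ _ a b

/-- **`U(f)` maps the centre into the centre when `L = f₁(L₁) + f₂(L₂)` with commuting summands**: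
`U(f₁)(z)` commutes with `ι(f₁ x)` (as `z` is central) and with `ι(f₂ y)` (commuting images), hence
with all of `U(L)`. [folklore] -/
theorem envMap_center_le_center {f₁ : L₁ →ₗ⁅R⁆ L} {f₂ : L₂ →ₗ⁅R⁆ L} (hf : ∀ x y, ⁅f₁ x, f₂ y⁆ = 0)
    (hsum : ∀ w : L, ∃ (x : L₁) (y : L₂), w = f₁ x + f₂ y)
    {z : UniversalEnvelopingAlgebra R L₁} (hz : z ∈ Subalgebra.center R (UniversalEnvelopingAlgebra R L₁)) :
    envMap f₁ z ∈ Subalgebra.center R (UniversalEnvelopingAlgebra R L) := by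
  rw [Subalgebra.mem_center_iff]
  intro u
  induction u using Literature.Algebra.Lie.UEnv.induction_on with
  | algebraMap r => exact (Algebra.commute_algebraMap_left r _).eq
  | ι_mem w =>
    obtain ⟨x, y, rfl⟩ := hsum w
    rw [map_add, add_mul, mul_add, ← envMap_ι f₁ x, ← map_mul, ← map_mul,
      Subalgebra.mem_center_iff.mp hz, ← envMap_ι f₂ y]
    congr 1
    exact ((commute_envMap hf z (ι R y)).eq).symm
  | mul a b ha hb => rw [mul_assoc, hb, ← mul_assoc, ha, mul_assoc]
  | add a b ha hb => rw [add_mul, mul_add, ha, hb]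

end Maps

/-! ### Product PBW bases: `prodMap` on ordered monomials -/

section PBW

variable {R : Type*} [CommRing R] {L₁ L₂ L : Type*} [LieRing L₁] [LieAlgebra R L₁]
  [LieRing L₂] [LieAlgebra R L₂] [LieRing L] [LieAlgebra R L]
  {f₁ : L₁ →ₗ⁅R⁆ L} {f₂ : L₂ →ₗ⁅R⁆ L}
  {σ₁ σ₂ : Type*} {b₁ : Module.Basis σ₁ R L₁} {b₂ : Module.Basis σ₂ R L₂}
  {b : Module.Basis (σ₁ ⊕ₗ σ₂) R L}

/-- `U(f₁)` on words of the first basis: the same word in the letters `inl`. [folklore] -/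
theorem envMap_word_inl (hb₁ : ∀ i, b (toLex (Sum.inl i)) = f₁ (b₁ i)) (l : List σ₁) :
    envMap f₁ (word b₁ l) = word b (l.map (toLex ∘ Sum.inl)) := by
  induction l with
  | nil => rw [word_nil, map_one, List.map_nil, word_nil]
  | cons i l ih =>
    rw [word_cons, map_mul, ih, envMap_ι, ← hb₁, List.map_cons, word_cons]
    rfl

/-- `U(f₂)` on words of the second basis: the same word in the letters `inr`. [folklore] -/
theorem envMap_word_inr (hb₂ : ∀ j, b (toLex (Sum.inr j)) = f₂ (b₂ j)) (l : List σ₂) :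
    envMap f₂ (word b₂ l) = word b (l.map (toLex ∘ Sum.inr)) := by
  induction l with
  | nil => rw [word_nil, map_one, List.map_nil, word_nil]
  | cons j l ih =>
    rw [word_cons, map_mul, ih, envMap_ι, ← hb₂, List.map_cons, word_cons]
    rfl

/-- Sorting commutes with an order embedding (private copy of `HCLevi.sort_map_of_strictMono` of
`HarishChandraLeviBlocks`, which is not imported into this general file). [folklore] -/
private theorem sort_map_of_strictMono' {α β : Type*} [LinearOrder α] [LinearOrder β] (f : α → β)
    (hf : StrictMono f) (m : Multiset α) : (m.map f).sort = (m.sort).map f :=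
  (Multiset.map_sort f m (· ≤ ·) (· ≤ ·) fun _ _ _ _ ↦ hf.le_iff_le.symm).symm

/-- Sorting a sum of multisets one of which lies entirely (weakly) below the other (private copy of
`HCLevi.sort_add_of_forall_le`). [folklore] -/
private theorem sort_add_of_forall_le' {α : Type*} [LinearOrder α] (m m' : Multiset α)
    (h : ∀ a ∈ m, ∀ b ∈ m', a ≤ b) : (m + m').sort = m.sort ++ m'.sort := by
  symm
  refine List.Perm.eq_of_pairwise (fun a b _ _ h₁ h₂ ↦ le_antisymm h₁ h₂) ?_ (Multiset.pairwise_sort _ _) ?_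
  · rw [List.pairwise_append]
    refine ⟨Multiset.pairwise_sort _ _, Multiset.pairwise_sort _ _, fun a ha b hb ↦ ?_⟩
    exact h a ((Multiset.mem_sort _).mp ha) b ((Multiset.mem_sort _).mp hb)
  · rw [← Multiset.coe_eq_coe, ← Multiset.coe_add, Multiset.sort_eq, Multiset.sort_eq, Multiset.sort_eq]

variable [LinearOrder σ₁] [LinearOrder σ₂]

/-- `U(f₁)` on ordered monomials: `U(f₁)(x_s) = x_{s ∘ inl⁻¹}`. [folklore] -/
theorem envMap_ordMonomial_inl (hb₁ : ∀ i, b (toLex (Sum.inl i)) = f₁ (b₁ i)) (s : σ₁ →₀ ℕ) :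
    envMap f₁ (ordMonomial b₁ s) = ordMonomial b (s.mapDomain (toLex ∘ Sum.inl)) := by
  rw [ordMonomial, ordMonomial, envMap_word_inl hb₁, ← Finsupp.toMultiset_map,
    sort_map_of_strictMono' _ Sum.Lex.inl_strictMono]

/-- `U(f₂)` on ordered monomials. [folklore] -/
theorem envMap_ordMonomial_inr (hb₂ : ∀ j, b (toLex (Sum.inr j)) = f₂ (b₂ j)) (t : σ₂ →₀ ℕ) :
    envMap f₂ (ordMonomial b₂ t) = ordMonomial b (t.mapDomain (toLex ∘ Sum.inr)) := by
  rw [ordMonomial, ordMonomial, envMap_word_inr hb₂, ← Finsupp.toMultiset_map,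
    sort_map_of_strictMono' _ Sum.Lex.inr_strictMono]

omit [LinearOrder σ₁] [LinearOrder σ₂] in
/-- The multi-index on `σ₁ ⊕ σ₂` with prescribed restrictions to the two summands. [folklore] -/
def combine (s : σ₁ →₀ ℕ) (t : σ₂ →₀ ℕ) : (σ₁ ⊕ₗ σ₂) →₀ ℕ :=
  s.mapDomain (toLex ∘ Sum.inl) + t.mapDomain (toLex ∘ Sum.inr)

omit [LinearOrder σ₁] [LinearOrder σ₂] in
/-- `combine s t` restricted to the first summand is `s`. [folklore] -/
@[simp]
theorem combine_inl (s : σ₁ →₀ ℕ) (t : σ₂ →₀ ℕ) (i : σ₁) : combine s t (toLex (Sum.inl i)) = s i := by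
  rw [combine, Finsupp.add_apply, show toLex (Sum.inl i : σ₁ ⊕ σ₂) = (toLex ∘ Sum.inl) i from rfl,
    Finsupp.mapDomain_apply (toLex.injective.comp Sum.inl_injective),
    Finsupp.mapDomain_notin_range, add_zero]
  rintro ⟨j, hj⟩
  exact Sum.inl_ne_inr (toLex.injective hj.symm)

omit [LinearOrder σ₁] [LinearOrder σ₂] in
/-- `combine s t` restricted to the second summand is `t`. [folklore] -/
@[simp]
theorem combine_inr (s : σ₁ →₀ ℕ) (t : σ₂ →₀ ℕ) (j : σ₂) : combine s t (toLex (Sum.inr j)) = t j := by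
  rw [combine, Finsupp.add_apply, show toLex (Sum.inr j : σ₁ ⊕ σ₂) = (toLex ∘ Sum.inr) j from rfl,
    Finsupp.mapDomain_apply (toLex.injective.comp Sum.inr_injective),
    Finsupp.mapDomain_notin_range, zero_add]
  rintro ⟨i, hi⟩
  exact Sum.inr_ne_inl (toLex.injective hi.symm)

omit [LinearOrder σ₁] [LinearOrder σ₂] in
/-- `combine` is injective. [folklore] -/
theorem combine_injective :
    Function.Injective (fun p : (σ₁ →₀ ℕ) × (σ₂ →₀ ℕ) ↦ combine p.1 p.2) := by
  rintro ⟨s, t⟩ ⟨s', t'⟩ h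
  simp only at h
  refine Prod.ext (Finsupp.ext fun i ↦ ?_) (Finsupp.ext fun j ↦ ?_)
  · rw [← combine_inl s t i, h, combine_inl]
  · rw [← combine_inr s t j, h, combine_inr]

omit [LinearOrder σ₁] [LinearOrder σ₂] in
/-- `combine` is surjective: every multi-index on `σ₁ ⊕ σ₂` is determined by its two restrictions.
[folklore] -/
theorem exists_combine_eq (u : (σ₁ ⊕ₗ σ₂) →₀ ℕ) : ∃ (s : σ₁ →₀ ℕ) (t : σ₂ →₀ ℕ), combine s t = u := by
  classical
  refine ⟨u.comapDomain (toLex ∘ Sum.inl) (toLex.injective.comp Sum.inl_injective).injOn,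
    u.comapDomain (toLex ∘ Sum.inr) (toLex.injective.comp Sum.inr_injective).injOn, Finsupp.ext fun v ↦ ?_⟩
  obtain ⟨x, rfl⟩ := toLex.surjective v
  rcases x with i | j
  · rw [combine_inl, Finsupp.comapDomain_apply]
    rfl
  · rw [combine_inr, Finsupp.comapDomain_apply]
    rfl

/-- **`prodMap` sends tensor PBW basis vectors to PBW basis vectors**: `prodMap (x_s ⊗ x_t) = x_{s ⊔ t}`
(the letters of `L₁` precede those of `L₂` in `σ₁ ⊕ₗ σ₂`). [cite: Humphreys1972, §17.3 Corollaries C–D] -/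
theorem prodMap_tmul_ordMonomial (hf : ∀ x y, ⁅f₁ x, f₂ y⁆ = 0)
    (hb₁ : ∀ i, b (toLex (Sum.inl i)) = f₁ (b₁ i)) (hb₂ : ∀ j, b (toLex (Sum.inr j)) = f₂ (b₂ j))
    (s : σ₁ →₀ ℕ) (t : σ₂ →₀ ℕ) :
    prodMap f₁ f₂ hf (ordMonomial b₁ s ⊗ₜ ordMonomial b₂ t) = ordMonomial b (combine s t) := by
  rw [prodMap_tmul, envMap_ordMonomial_inl hb₁, envMap_ordMonomial_inr hb₂, ordMonomial, ordMonomial,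
    ordMonomial, ← word_append, combine, Finsupp.toMultiset_add, sort_add_of_forall_le']
  intro a ha c hc
  rw [← Finsupp.toMultiset_map, Multiset.mem_map] at ha hc
  obtain ⟨i, -, rfl⟩ := ha
  obtain ⟨j, -, rfl⟩ := hc
  exact (Sum.Lex.inl_lt_inr i j).le

/-- `prodMap` on the tensor product PBW basis. [folklore] -/
theorem prodMap_basis (hf : ∀ x y, ⁅f₁ x, f₂ y⁆ = 0)
    (hb₁ : ∀ i, b (toLex (Sum.inl i)) = f₁ (b₁ i)) (hb₂ : ∀ j, b (toLex (Sum.inr j)) = f₂ (b₂ j))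
    (p : (σ₁ →₀ ℕ) × (σ₂ →₀ ℕ)) :
    prodMap f₁ f₂ hf ((pbwBasis b₁).tensorProduct (pbwBasis b₂) p) = pbwBasis b (combine p.1 p.2) := by
  rw [Module.Basis.tensorProduct_apply', pbwBasis_apply, pbwBasis_apply, pbwBasis_apply,
    prodMap_tmul_ordMonomial hf hb₁ hb₂]

/-- `prodMap` in coordinates: the PBW coordinates of `prodMap w` are the tensor PBW coordinates of `w`
transported along `combine`. [folklore] -/
theorem repr_prodMap (hf : ∀ x y, ⁅f₁ x, f₂ y⁆ = 0)
    (hb₁ : ∀ i, b (toLex (Sum.inl i)) = f₁ (b₁ i)) (hb₂ : ∀ j, b (toLex (Sum.inr j)) = f₂ (b₂ j))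
    (w : UniversalEnvelopingAlgebra R L₁ ⊗[R] UniversalEnvelopingAlgebra R L₂) :
    (pbwBasis b).repr (prodMap f₁ f₂ hf w) =
      (((pbwBasis b₁).tensorProduct (pbwBasis b₂)).repr w).mapDomain (fun p ↦ combine p.1 p.2) := by
  conv_lhs => rw [← ((pbwBasis b₁).tensorProduct (pbwBasis b₂)).linearCombination_repr w]
  rw [Finsupp.linearCombination_apply, map_finsuppSum, map_finsuppSum, Finsupp.mapDomain]
  simp only [Finsupp.sum]
  refine Finset.sum_congr rfl fun p _ ↦ ?_
  rw [map_smul, map_smul, prodMap_basis hf hb₁ hb₂, Module.Basis.repr_self, Finsupp.smul_single, smul_eq_mul,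
    mul_one]

/-- **`prodMap` is injective** (in a product PBW basis). [cite: Dixmier1977, 2.2.10] -/
theorem prodMap_injective (hf : ∀ x y, ⁅f₁ x, f₂ y⁆ = 0)
    (hb₁ : ∀ i, b (toLex (Sum.inl i)) = f₁ (b₁ i)) (hb₂ : ∀ j, b (toLex (Sum.inr j)) = f₂ (b₂ j)) :
    Function.Injective (prodMap f₁ f₂ hf) := by
  intro w w' h
  have h' := congrArg (pbwBasis b).repr h
  rw [repr_prodMap hf hb₁ hb₂, repr_prodMap hf hb₁ hb₂] at h'
  exact ((pbwBasis b₁).tensorProduct (pbwBasis b₂)).repr.injective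
    (Finsupp.mapDomain_injective combine_injective h')

/-- **`prodMap` is surjective** (every PBW basis vector of `U(L)` is hit). [cite: Dixmier1977, 2.2.10] -/
theorem prodMap_surjective (hf : ∀ x y, ⁅f₁ x, f₂ y⁆ = 0)
    (hb₁ : ∀ i, b (toLex (Sum.inl i)) = f₁ (b₁ i)) (hb₂ : ∀ j, b (toLex (Sum.inr j)) = f₂ (b₂ j)) :
    Function.Surjective (prodMap f₁ f₂ hf) := by
  intro u
  have hu : u ∈ LinearMap.range (prodMap f₁ f₂ hf).toLinearMap := by
    rw [← (pbwBasis b).linearCombination_repr u, Finsupp.linearCombination_apply]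
    refine Submodule.finsuppSum_mem _ _ _ _ fun v _ ↦ Submodule.smul_mem _ _ ?_
    obtain ⟨s, t, rfl⟩ := exists_combine_eq v
    exact ⟨ordMonomial b₁ s ⊗ₜ ordMonomial b₂ t, by
      rw [AlgHom.toLinearMap_apply, prodMap_tmul_ordMonomial hf hb₁ hb₂, pbwBasis_apply]⟩
  obtain ⟨w, hw⟩ := hu
  exact ⟨w, hw⟩

end PBW

/-! ### Basis-free statements over a field: bijectivity and the centre -/

section Field

variable {𝕂 : Type*} [Field 𝕂] {L₁ L₂ L : Type*} [LieRing L₁] [LieAlgebra 𝕂 L₁]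
  [LieRing L₂] [LieAlgebra 𝕂 L₂] [LieRing L] [LieAlgebra 𝕂 L]
  {f₁ : L₁ →ₗ⁅𝕂⁆ L} {f₂ : L₂ →ₗ⁅𝕂⁆ L}

/-- The product basis of `L ≅ L₁ × L₂` built from chosen bases of the factors, indexed by the
lexicographic sum of their index types (letters of `L₁` first). [folklore] -/
def prodBasis (e : (L₁ × L₂) ≃ₗ[𝕂] L) :
    Module.Basis (Module.Free.ChooseBasisIndex 𝕂 L₁ ⊕ₗ Module.Free.ChooseBasisIndex 𝕂 L₂) 𝕂 L :=
  (((Module.Free.chooseBasis 𝕂 L₁).prod (Module.Free.chooseBasis 𝕂 L₂)).map e).reindex toLex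

/-- The product basis on the first summand. [folklore] -/
theorem prodBasis_inl (e : (L₁ × L₂) ≃ₗ[𝕂] L) (he₁ : ∀ x, e (x, 0) = f₁ x)
    (i : Module.Free.ChooseBasisIndex 𝕂 L₁) :
    prodBasis e (toLex (Sum.inl i)) = f₁ (Module.Free.chooseBasis 𝕂 L₁ i) := by
  rw [prodBasis, Module.Basis.reindex_apply, Module.Basis.map_apply, ← he₁]
  congr 1
  exact Prod.ext (Module.Basis.prod_apply_inl_fst _ _ i) (Module.Basis.prod_apply_inl_snd _ _ i)

/-- The product basis on the second summand. [folklore] -/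
theorem prodBasis_inr (e : (L₁ × L₂) ≃ₗ[𝕂] L) (he₂ : ∀ y, e (0, y) = f₂ y)
    (j : Module.Free.ChooseBasisIndex 𝕂 L₂) :
    prodBasis e (toLex (Sum.inr j)) = f₂ (Module.Free.chooseBasis 𝕂 L₂ j) := by
  rw [prodBasis, Module.Basis.reindex_apply, Module.Basis.map_apply, ← he₂]
  congr 1
  exact Prod.ext (Module.Basis.prod_apply_inr_fst _ _ j) (Module.Basis.prod_apply_inr_snd _ _ j)

/-- **`U(L₁) ⊗ U(L₂) ≅ U(L₁ × L₂)`**: for Lie algebra maps `f₁, f₂` with commuting images inducing a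
linear isomorphism `L₁ × L₂ ≅ L`, the product map `a ⊗ b ↦ U(f₁)(a) U(f₂)(b)` is bijective (product
PBW bases for well-orderings of the chosen index types). Bourbaki, LIE I §2.2 Prop. 2; Dixmier 2.2.10.
[cite: Dixmier1977, 2.2.10] -/
theorem prodMap_bijective (hf : ∀ x y, ⁅f₁ x, f₂ y⁆ = 0) (e : (L₁ × L₂) ≃ₗ[𝕂] L)
    (he₁ : ∀ x, e (x, 0) = f₁ x) (he₂ : ∀ y, e (0, y) = f₂ y) :
    Function.Bijective (prodMap f₁ f₂ hf) := by
  letI : LinearOrder (Module.Free.ChooseBasisIndex 𝕂 L₁) := IsWellOrder.linearOrder WellOrderingRel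
  letI : LinearOrder (Module.Free.ChooseBasisIndex 𝕂 L₂) := IsWellOrder.linearOrder WellOrderingRel
  exact ⟨prodMap_injective (b₁ := Module.Free.chooseBasis 𝕂 L₁) (b₂ := Module.Free.chooseBasis 𝕂 L₂)
      (b := prodBasis e) hf (prodBasis_inl e he₁) (prodBasis_inr e he₂),
    prodMap_surjective (b₁ := Module.Free.chooseBasis 𝕂 L₁) (b₂ := Module.Free.chooseBasis 𝕂 L₂)
      (b := prodBasis e) hf (prodBasis_inl e he₁) (prodBasis_inr e he₂)⟩

/-- **The centre of `U(L₁ × L₂)` comes from `Z(U(L₁)) ⊗ Z(U(L₂))`**: every central element of `U(L)`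
is `prodMap` of an element of `Z(U(L₁)) ⊗ Z(U(L₂))` (the centre of a tensor product of algebras over
a field is the tensor product of the centres). Dixmier, 4.2; Bourbaki, LIE I §2.2.
[cite: Dixmier1977, 2.2.10 and 4.2] -/
theorem exists_center_tmul_eq (hf : ∀ x y, ⁅f₁ x, f₂ y⁆ = 0) (e : (L₁ × L₂) ≃ₗ[𝕂] L)
    (he₁ : ∀ x, e (x, 0) = f₁ x) (he₂ : ∀ y, e (0, y) = f₂ y)
    {z : UniversalEnvelopingAlgebra 𝕂 L} (hz : z ∈ Subalgebra.center 𝕂 (UniversalEnvelopingAlgebra 𝕂 L)) :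
    ∃ t : Subalgebra.center 𝕂 (UniversalEnvelopingAlgebra 𝕂 L₁) ⊗[𝕂]
        Subalgebra.center 𝕂 (UniversalEnvelopingAlgebra 𝕂 L₂),
      prodMap f₁ f₂ hf (Algebra.TensorProduct.map
        (Subalgebra.center 𝕂 (UniversalEnvelopingAlgebra 𝕂 L₁)).val
        (Subalgebra.center 𝕂 (UniversalEnvelopingAlgebra 𝕂 L₂)).val t) = z := by
  have hbij := prodMap_bijective hf e he₁ he₂
  obtain ⟨t₀, rfl⟩ := hbij.2 z
  -- `t₀` is central in the tensor product
  have hcen : ∀ w, w * t₀ = t₀ * w := fun w ↦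
    hbij.1 (by rw [map_mul, map_mul]; exact Subalgebra.mem_center_iff.mp hz _)
  -- hence in `Z ⊗ U(L₂)`
  have h1 : t₀ ∈ Subalgebra.centralizer 𝕂
      ((Algebra.TensorProduct.includeLeft : UniversalEnvelopingAlgebra 𝕂 L₁ →ₐ[𝕂]
        UniversalEnvelopingAlgebra 𝕂 L₁ ⊗[𝕂] UniversalEnvelopingAlgebra 𝕂 L₂).range :
          Set (UniversalEnvelopingAlgebra 𝕂 L₁ ⊗[𝕂] UniversalEnvelopingAlgebra 𝕂 L₂)) := by
    rw [Subalgebra.mem_centralizer_iff]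
    exact fun w _ ↦ hcen w
  rw [Subalgebra.centralizer_coe_range_includeLeft_eq_center_tensorProduct] at h1
  obtain ⟨t₁, rfl⟩ := (AlgHom.mem_range _).mp h1
  -- `t₁` commutes with `1 ⊗ U(L₂)`
  have hinj₁ : Function.Injective (Algebra.TensorProduct.map
      (Subalgebra.center 𝕂 (UniversalEnvelopingAlgebra 𝕂 L₁)).val
      (AlgHom.id 𝕂 (UniversalEnvelopingAlgebra 𝕂 L₂))) :=
    TensorProduct.map_injective_of_flat_flat _ _ Subtype.val_injective Function.injective_id
  have h2 : t₁ ∈ Subalgebra.centralizer 𝕂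
      ((Algebra.TensorProduct.includeRight : UniversalEnvelopingAlgebra 𝕂 L₂ →ₐ[𝕂]
        Subalgebra.center 𝕂 (UniversalEnvelopingAlgebra 𝕂 L₁) ⊗[𝕂] UniversalEnvelopingAlgebra 𝕂 L₂).range :
          Set (Subalgebra.center 𝕂 (UniversalEnvelopingAlgebra 𝕂 L₁) ⊗[𝕂] UniversalEnvelopingAlgebra 𝕂 L₂)) := by
    rw [Subalgebra.mem_centralizer_iff]
    intro x hx
    obtain ⟨c, rfl⟩ := (AlgHom.mem_range _).mp hx
    refine hinj₁ ?_
    rw [map_mul, map_mul]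
    have e' : Algebra.TensorProduct.map (Subalgebra.center 𝕂 (UniversalEnvelopingAlgebra 𝕂 L₁)).val
        (AlgHom.id 𝕂 (UniversalEnvelopingAlgebra 𝕂 L₂)) (Algebra.TensorProduct.includeRight c) =
          (1 : UniversalEnvelopingAlgebra 𝕂 L₁) ⊗ₜ c := by
      rw [Algebra.TensorProduct.includeRight_apply, Algebra.TensorProduct.map_tmul, map_one, AlgHom.id_apply]
    rw [e']
    exact hcen _
  rw [Subalgebra.centralizer_range_includeRight_eq_center_tensorProduct] at h2
  obtain ⟨t₂, rfl⟩ := (AlgHom.mem_range _).mp h2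
  refine ⟨t₂, ?_⟩
  have e' := Algebra.TensorProduct.map_comp (Subalgebra.center 𝕂 (UniversalEnvelopingAlgebra 𝕂 L₁)).val
    (AlgHom.id 𝕂 _) (AlgHom.id 𝕂 (UniversalEnvelopingAlgebra 𝕂 L₂))
    (Subalgebra.center 𝕂 (UniversalEnvelopingAlgebra 𝕂 L₂)).val
  rw [AlgHom.comp_id, AlgHom.id_comp] at e'
  rw [e', AlgHom.comp_apply]

/-- **`Z(U(L₁ × L₂))` is generated by the centres of the factors**: every central element of `U(L)`
lies in the subalgebra generated by `U(f₁)(Z(U(L₁)))` and `U(f₂)(Z(U(L₂)))` — in fact it is a finite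
sum `∑ U(f₁)(aᵢ) U(f₂)(cᵢ)` with `aᵢ, cᵢ` central. Dixmier, 4.2 with 2.2.10.
[cite: Dixmier1977, 2.2.10 and 4.2] -/
theorem center_le_adjoin (hf : ∀ x y, ⁅f₁ x, f₂ y⁆ = 0) (e : (L₁ × L₂) ≃ₗ[𝕂] L)
    (he₁ : ∀ x, e (x, 0) = f₁ x) (he₂ : ∀ y, e (0, y) = f₂ y) :
    Subalgebra.center 𝕂 (UniversalEnvelopingAlgebra 𝕂 L) ≤
      Algebra.adjoin 𝕂 (envMap f₁ '' (Subalgebra.center 𝕂 (UniversalEnvelopingAlgebra 𝕂 L₁) : Set _) ∪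
        envMap f₂ '' (Subalgebra.center 𝕂 (UniversalEnvelopingAlgebra 𝕂 L₂) : Set _)) := by
  intro z hz
  obtain ⟨t, rfl⟩ := exists_center_tmul_eq hf e he₁ he₂ hz
  clear hz
  induction t using TensorProduct.induction_on with
  | zero => rw [map_zero, map_zero]; exact Subalgebra.zero_mem _
  | tmul a c =>
    rw [Algebra.TensorProduct.map_tmul, prodMap_tmul]
    refine Subalgebra.mul_mem _ (Algebra.subset_adjoin (Set.mem_union_left _ ⟨a, a.2, rfl⟩))
      (Algebra.subset_adjoin (Set.mem_union_right _ ⟨c, c.2, rfl⟩))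
  | add x y hx hy => rw [map_add, map_add]; exact Subalgebra.add_mem _ hx hy

/-- **The centre of `U(L₁ × L₂)`, exactly**: it is the subalgebra generated by `U(f₁)(Z(U(L₁)))` and
`U(f₂)(Z(U(L₂)))`. [cite: Dixmier1977, 2.2.10 and 4.2] -/
theorem center_eq_adjoin (hf : ∀ x y, ⁅f₁ x, f₂ y⁆ = 0) (e : (L₁ × L₂) ≃ₗ[𝕂] L)
    (he₁ : ∀ x, e (x, 0) = f₁ x) (he₂ : ∀ y, e (0, y) = f₂ y) :
    Subalgebra.center 𝕂 (UniversalEnvelopingAlgebra 𝕂 L) =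
      Algebra.adjoin 𝕂 (envMap f₁ '' (Subalgebra.center 𝕂 (UniversalEnvelopingAlgebra 𝕂 L₁) : Set _) ∪
        envMap f₂ '' (Subalgebra.center 𝕂 (UniversalEnvelopingAlgebra 𝕂 L₂) : Set _)) := by
  refine le_antisymm (center_le_adjoin hf e he₁ he₂) (Algebra.adjoin_le ?_)
  have hsum : ∀ w : L, ∃ (x : L₁) (y : L₂), w = f₁ x + f₂ y := fun w ↦ by
    obtain ⟨⟨x, y⟩, rfl⟩ := e.surjective w
    refine ⟨x, y, ?_⟩
    rw [← he₁, ← he₂, ← LinearEquiv.map_add, Prod.mk_add_mk, add_zero, zero_add]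
  have hsum' : ∀ w : L, ∃ (y : L₂) (x : L₁), w = f₂ y + f₁ x := fun w ↦ by
    obtain ⟨x, y, rfl⟩ := hsum w
    exact ⟨y, x, add_comm _ _⟩
  have hf' : ∀ y x, ⁅f₂ y, f₁ x⁆ = 0 := fun y x ↦ by rw [← lie_skew, hf, neg_zero]
  rintro _ (⟨a, ha, rfl⟩ | ⟨c, hc, rfl⟩)
  · exact envMap_center_le_center hf hsum ha
  · exact envMap_center_le_center hf' hsum' hc

end Field

end Literature.Algebra.Lie.UEnvProduct
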